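/-
HONEST FRAMING: systematic search; no irrationality claim unless certified.
-/
import Summits.KontsevichZagierPeriods.Zeta5Search.WedgeDictionaryTransportI1
import Summits.KontsevichZagierPeriods.Zeta5Search.WedgeDictionaryConsequences
import HarnessLib

/-!
# Assembly glue for the terminal-template programme: partner change and placement pull-backs

HONEST FRAMING: systematic search; no irrationality claim unless certified.
OUR work (Summit side; cell `pub-zeta5`, planner gen-1 g17, 2026-08-21; memo `pub-zeta5-gen-1/D2-TERMINAL-g17.md` §2c).

The pointwise statement `ExplicitPQAt a j` mentions the partner `j` through `P̂_d(a,j)` and `P_d(a,j)`.  By the LINEARITY of the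
canonical coefficients `U, W, V` under the partner shift (`coeff_update_sub`, tree) both dictionary parts are partner-free on the
region, hence `ExplicitPQAt a j → ExplicitPQAt a j'` for any two admissible partners.  This is the glue that lets the assembly of
`explicitPQ` (via `explicitPQ_of_terminal`) use a template proved for ONE partner at every admissible partner.  Elementary algebra only;
nothing analytic, nothing about irrationality.

PLACEMENT PULL-BACKS.  The five generators `p₀₁, p₁₂, h, h', i₁` are involutions on `a` and permute the dual slots by
`(34), (35), (36), (46), (14)(23)(57)`; so `explicitPQ` at `a` follows from `explicitPQ` at `g a` (any admissible partners on both
sides), given the region hypotheses at both points and the cited invariance (27) (`invariance_of_converges'`):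
`explicitPQAt_pull_genP01/P12/H/Hp/I1`.  Chaining these along the words of `code/gen1/g17/data/PLACEMENT-WORDS.md` moves every
placement of a terminal multiset to the placement at which a template file proves it (memo §2c/§2d). [folklore]
-/

noncomputable section

open Finset

namespace Summit.KontsevichZagierPeriods.Zeta5Search.WedgeDictionary

open Summit.KontsevichZagierPeriods.Zeta5Search.DualSeries
open Literature.NumberTheory.Irrationality.BrownZudilin2022
open Literature.NumberTheory.Transcendental (zetaValue)

/-- `P̂_d(a, i+1) = P̂_d(a, k+1)` on the box with `d ≥ 0` (partner independence of the `P̂`-part). [folklore] -/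
theorem dictPhat_partner_eq (a : Fin 8 → ℤ) (hb : InBox (bOfA a)) (hd : 0 ≤ dOf (bOfA a)) {i k : ℕ}
    (hi : i ∈ range 7) (hk : k ∈ range 7) (hli : bOfA a (i + 1) ≤ bOfA a 0) (hlk : bOfA a (k + 1) ≤ bOfA a 0) :
    dictPhat a (i + 1) = dictPhat a (k + 1) := by
  obtain ⟨hU, -, hV⟩ := coeff_update_sub (bOfA a) hb hd hi hk hli hlk
  unfold dictPhat
  linear_combination rhoOf a * (coeffU (bOfA a) * hV - coeffV (bOfA a) * hU)

/-- `P_d(a, i+1) = P_d(a, k+1)` on the box with `d ≥ 0` (partner independence of the `P`-part). [folklore] -/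
theorem dictP_partner_eq (a : Fin 8 → ℤ) (hb : InBox (bOfA a)) (hd : 0 ≤ dOf (bOfA a)) {i k : ℕ}
    (hi : i ∈ range 7) (hk : k ∈ range 7) (hli : bOfA a (i + 1) ≤ bOfA a 0) (hlk : bOfA a (k + 1) ≤ bOfA a 0) :
    dictP a (i + 1) = dictP a (k + 1) := by
  obtain ⟨-, hW, hV⟩ := coeff_update_sub (bOfA a) hb hd hi hk hli hlk
  unfold dictP
  linear_combination rhoOf a * (coeffV (bOfA a) * hW - coeffW (bOfA a) * hV)

/-- The region hypotheses put `b(a)` in the box. [folklore] -/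
theorem inBox_of_regionHyp {a : Fin 8 → ℤ} {j : ℕ} (hr : RegionHyp a j) : InBox (bOfA a) := by
  obtain ⟨hj, -, hreg, -, hpart⟩ := hr
  refine ⟨?_, fun l hl => ?_⟩
  · have h1 := (hreg j hj).1
    omega
  · have hl' := mem_range.mp hl
    have h2 := hreg (l + 1) (by simp only [mem_Icc]; omega)
    omega

/-- **PARTNER CHANGE.** `ExplicitPQAt a j → ExplicitPQAt a j'` for any two admissible partners `j, j'` at a region point. [folklore] -/
theorem explicitPQAt_partner {a : Fin 8 → ℤ} {j j' : ℕ} (hr : RegionHyp a j) (hr' : RegionHyp a j')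
    (h : ExplicitPQAt a j) : ExplicitPQAt a j' := by
  have hb : InBox (bOfA a) := inBox_of_regionHyp hr
  obtain ⟨hj, -, hreg, hd, hpart⟩ := hr
  obtain ⟨hj', -, -, -, hpart'⟩ := hr'
  simp only [mem_Icc] at hj hj'
  obtain ⟨i, rfl⟩ : ∃ i, j = i + 1 := ⟨j - 1, by omega⟩
  obtain ⟨k, rfl⟩ : ∃ k, j' = k + 1 := ⟨j' - 1, by omega⟩
  have hi : i ∈ range 7 := mem_range.mpr (by omega)
  have hk : k ∈ range 7 := mem_range.mpr (by omega)
  have hli : bOfA a (i + 1) ≤ bOfA a 0 := by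
    have h1 := (hreg (i + 1) (by simp only [mem_Icc]; omega)).1
    omega
  have hlk : bOfA a (k + 1) ≤ bOfA a 0 := by
    have h1 := (hreg (k + 1) (by simp only [mem_Icc]; omega)).1
    omega
  unfold ExplicitPQAt at h ⊢
  rw [← dictPhat_partner_eq a hb hd hi hk hli hlk, ← dictP_partner_eq a hb hd hi hk hli hlk]
  exact h

/-- Region points always admit SOME `ExplicitPQAt`-transfer between partners: the `iff` form. [folklore] -/
theorem explicitPQAt_partner_iff {a : Fin 8 → ℤ} {j j' : ℕ} (hr : RegionHyp a j) (hr' : RegionHyp a j') :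
    ExplicitPQAt a j ↔ ExplicitPQAt a j' :=
  ⟨explicitPQAt_partner hr hr', explicitPQAt_partner hr' hr⟩


/-! ## Involutions -/

/-- `p₀₁` is an involution. (docstring added by the filing lane, P2 g5) -/
theorem genP01_invol (a : Fin 8 → ℤ) : genP01 (genP01 a) = a := by
  ext i; fin_cases i <;> simp [genP01]

/-- `p₁₂` is an involution. (docstring added by the filing lane, P2 g5) -/
theorem genP12_invol (a : Fin 8 → ℤ) : genP12 (genP12 a) = a := by
  ext i; fin_cases i <;> simp [genP12]
  ring

/-- `h` is an involution. (docstring added by the filing lane, P2 g5) -/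
theorem genH_invol (a : Fin 8 → ℤ) : genH (genH a) = a := by
  ext i; fin_cases i <;> simp [genH]

/-- `h'` is an involution. (docstring added by the filing lane, P2 g5) -/
theorem genHp_invol (a : Fin 8 → ℤ) : genH' (genH' a) = a := by
  ext i; fin_cases i <;> simp [genH'] <;> ring

/-- `i₁` is an involution. (docstring added by the filing lane, P2 g5) -/
theorem genI1_invol (a : Fin 8 → ℤ) : genI1 (genI1 a) = a := by
  ext i; fin_cases i <;> simp [genI1]
  ring

/-! ## Pull-backs along the generators (any admissible partners) -/

/-- An admissible partner index is one of `1, …, 7`. (docstring added by the filing lane, P2 g5) -/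
private theorem fin7_of_partner {a : Fin 8 → ℤ} {j' : ℕ} (hr : RegionHyp a j') : ∃ i : Fin 7, j' = i.val + 1 := by
  have hj' := hr.1
  simp only [mem_Icc] at hj'
  exact ⟨⟨j' - 1, by omega⟩, by simp only; omega⟩

/-- **Pull-back along `p₀₁`** (slots `3 ↔ 4`): `explicitPQ` at `p₀₁ a` (any partner) gives `explicitPQ` at `a` (any partner). [folklore] -/
theorem explicitPQAt_pull_genP01 (hInv : invariance_of_converges') {a : Fin 8 → ℤ} {j j' : ℕ}
    (hr : RegionHyp a j') (hr' : RegionHyp (genP01 a) j) (h : ExplicitPQAt (genP01 a) j) : ExplicitPQAt a j' := by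
  have e : genP01 (genP01 a) = a := genP01_invol a
  obtain ⟨i, hi⟩ := fin7_of_partner hr
  have hσ : (Equiv.swap (2 : Fin 7) 3) ((Equiv.swap (2 : Fin 7) 3) i) = i := Equiv.swap_apply_self _ _ _
  have hr₁ : RegionHyp (genP01 a) (((Equiv.swap (2 : Fin 7) 3) i).val + 1) :=
    regionHyp_transport (bOfA_genP01 a) hr'.2.1 ((Equiv.swap (2 : Fin 7) 3) i) (by rw [hσ]; exact hi) hr
  have h₁ := explicitPQAt_partner hr' hr₁ h
  have t := explicitPQAt_genP01 hInv (a := genP01 a) i rfl hr₁ (by rw [e]; exact hr.2.1) h₁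
  rw [e] at t
  rw [hi]
  exact t

/-- **Pull-back along `p₁₂`** (slots `3 ↔ 5`). [folklore] -/
theorem explicitPQAt_pull_genP12 (hInv : invariance_of_converges') {a : Fin 8 → ℤ} {j j' : ℕ}
    (hr : RegionHyp a j') (hr' : RegionHyp (genP12 a) j) (h : ExplicitPQAt (genP12 a) j) : ExplicitPQAt a j' := by
  have e : genP12 (genP12 a) = a := genP12_invol a
  obtain ⟨i, hi⟩ := fin7_of_partner hr
  have hσ : (Equiv.swap (2 : Fin 7) 4) ((Equiv.swap (2 : Fin 7) 4) i) = i := Equiv.swap_apply_self _ _ _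
  have hr₁ : RegionHyp (genP12 a) (((Equiv.swap (2 : Fin 7) 4) i).val + 1) :=
    regionHyp_transport (bOfA_genP12 a) hr'.2.1 ((Equiv.swap (2 : Fin 7) 4) i) (by rw [hσ]; exact hi) hr
  have h₁ := explicitPQAt_partner hr' hr₁ h
  have t := explicitPQAt_genP12 hInv (a := genP12 a) i rfl hr₁ (by rw [e]; exact hr.2.1) h₁
  rw [e] at t
  rw [hi]
  exact t

/-- **Pull-back along `h`** (slots `3 ↔ 6`). [folklore] -/
theorem explicitPQAt_pull_genH (hInv : invariance_of_converges') {a : Fin 8 → ℤ} {j j' : ℕ}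
    (hr : RegionHyp a j') (hr' : RegionHyp (genH a) j) (h : ExplicitPQAt (genH a) j) : ExplicitPQAt a j' := by
  have e : genH (genH a) = a := genH_invol a
  obtain ⟨i, hi⟩ := fin7_of_partner hr
  have hσ : (Equiv.swap (2 : Fin 7) 5) ((Equiv.swap (2 : Fin 7) 5) i) = i := Equiv.swap_apply_self _ _ _
  have hr₁ : RegionHyp (genH a) (((Equiv.swap (2 : Fin 7) 5) i).val + 1) :=
    regionHyp_transport (bOfA_genH a) hr'.2.1 ((Equiv.swap (2 : Fin 7) 5) i) (by rw [hσ]; exact hi) hr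
  have h₁ := explicitPQAt_partner hr' hr₁ h
  have t := explicitPQAt_genH hInv (a := genH a) i rfl hr₁ (by rw [e]; exact hr.2.1) h₁
  rw [e] at t
  rw [hi]
  exact t

/-- **Pull-back along `h'`** (slots `4 ↔ 6`). [folklore] -/
theorem explicitPQAt_pull_genHp (hInv : invariance_of_converges') {a : Fin 8 → ℤ} {j j' : ℕ}
    (hr : RegionHyp a j') (hr' : RegionHyp (genH' a) j) (h : ExplicitPQAt (genH' a) j) : ExplicitPQAt a j' := by
  have e : genH' (genH' a) = a := genHp_invol a
  obtain ⟨i, hi⟩ := fin7_of_partner hr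
  have hσ : (Equiv.swap (3 : Fin 7) 5) ((Equiv.swap (3 : Fin 7) 5) i) = i := Equiv.swap_apply_self _ _ _
  have hr₁ : RegionHyp (genH' a) (((Equiv.swap (3 : Fin 7) 5) i).val + 1) :=
    regionHyp_transport (bOfA_genHp a) hr'.2.1 ((Equiv.swap (3 : Fin 7) 5) i) (by rw [hσ]; exact hi) hr
  have h₁ := explicitPQAt_partner hr' hr₁ h
  have t := explicitPQAt_genHp hInv (a := genH' a) i rfl hr₁ (by rw [e]; exact hr.2.1) h₁
  rw [e] at t
  rw [hi]
  exact t

/-- **Pull-back along `i₁`** (slots `(14)(23)(57)`; no invariance-free convergence issue: `i₁` preserves the cone). [folklore] -/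
theorem explicitPQAt_pull_genI1 (hInv : invariance_of_converges') {a : Fin 8 → ℤ} {j j' : ℕ}
    (hr : RegionHyp a j') (hr' : RegionHyp (genI1 a) j) (h : ExplicitPQAt (genI1 a) j) : ExplicitPQAt a j' := by
  have e : genI1 (genI1 a) = a := genI1_invol a
  obtain ⟨i, hi⟩ := fin7_of_partner hr
  have hσ : slotPermI1 (slotPermI1 i) = i := slotPermI1_invol i
  have hr₁ : RegionHyp (genI1 a) ((slotPermI1 i).val + 1) :=
    regionHyp_transport (bOfA_genI1 a) hr'.2.1 (slotPermI1 i) (by rw [hσ]; exact hi) hr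
  have h₁ := explicitPQAt_partner hr' hr₁ h
  have t := explicitPQAt_genI1 hInv (a := genI1 a) i rfl hr₁ h₁
  rw [e] at t
  rw [hi]
  exact t

end Summit.KontsevichZagierPeriods.Zeta5Search.WedgeDictionary

end
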